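import Summits.QuantumFields.YangMills.Theorems.BalabanUVNodesN15PerCubeGreenNode
import Summits.QuantumFields.YangMills.Theorems.BalabanUVNodesN15PerCubeGreenNodeObjectsGradient
import Summits.QuantumFields.YangMills.Theorems.BalabanUVNodesN15PerCubeGreenTwoGridGradientNamedReg335HolderRate
import Summits.QuantumFields.YangMills.Theorems.BalabanUVNodesN15PerCubeGreenTwoGridEntryThreeNamedReg335HolderRate
import HarnessLib

/-!
# N15 = NE2, road (c) — PROGRAMME (PC), (PC-E-J-N): ★★★★ `T4EtaRate.NE2PlusOperator` BY NAME FOR THE NAMED SCALAR COVARIANT GREEN's FUNCTION FAMILY ON THE PRINTED PER-CUBE CLASS WITH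
# THE GRADIENT ENTRY CONSTRUCTED — ENTRIES 0, 1 (direction `μ₀`) AND 3 OF (3.42) CONSTRUCTED AND PROVED (n15-c∕392, n15-c∕420, n15-c∕396: THE inverses `(Δ_{R_U} + aQ′_TᵀQ′_T)⁻¹`, no
# gauge choice), ENTRY 2 DISPLAYED, `M = L^m` LIVE (dag-n15-c g36, n15-c∕422)

Cell `pub-ymgap`, seat `pub-ymgap-dag-n15-c` (generation g36; R134 (a) seat, strategy s1 «first missing estimate»; HUMAN RULING D-0062; chair R424 venue).
`bears_on: R4∕N15 · K3⁸ SpineGivenEndpointR13SepCoPHV (stmt-QuantumFields-27366)`; filed `--kind proof --supports stmt-QuantumFields-27366 --as helper` — COUNT-NEUTRAL.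
TWO theorems, 0 `def`, 0 `sorry`: ★★★★ `ne2PlusOperator_pc₀₁₃` and the corollary ★★★ `ne2ZeroOperator_pc₀₁₃` (`T4EtaRate.ne2Zero_of_ne2Plus` + n15-c∕398's non-vacuity `pcInstance_reg335_one`).
Imports BY NAME n15-c∕398 `…PerCubeGreenNode` (`pcRateConst_mono`, `pcInstance_reg335_one`; through it n15-c∕397's objects, n15-c∕396 entry 3, dag-n15-c g16 FILE 132, n15-b `OperatorReadout`),
n15-c∕421 `…PerCubeGreenNodeObjectsGradient` (`pcEntry1`, `pcOps₁`, `pcFamily₁`), n15-c∕420 `…GradientNamedReg335HolderRate` (★★★★ `uN_idef_covD_scGreenOp_of_reg910_rate`: entry 1).  The proof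
is n15-c∕398's VERBATIM with a THIRD constructed branch (entry 1, same scalar `step`) and the constants enlarged accordingly; generator `tools/build_F.py`.  Nothing in the tree is modified,
no landed name re-declared.

THE THEOREM `ne2PlusOperator_pc₀₁₃`.  For odd `L ≥ 7`, `a₀ > 0` (King's mass window), `c₃₅ > 0`, `c₄r ≥ 0`, `β₀ > 0`, trace-form-orthonormal coordinates `e` of `𝔲(m)` (`m ≥ 1`), a direction
`μ₀`: IF the consumer's entry-2 operator `E i 2` (`G′∇*_U`, the adjoint arrangement — its two-grid jet edition on the per-cube class is not in the tree) obeys, for `M₁ ≤ L^m`, `0 < α₀`,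
`L^m·α₀ ≤ a₁` and every `U′` in the class, the (3.42)-shaped block majorant `B₁·pref4(len)_2·e^{−δ₁d}·max(rf_{γ₁}(y), rf_{γ₁}(y′))` (uniform `M₁, δ₁, a₁, B₁, γ₁ > 0` — DISPLAYED), THEN
`T4EtaRate.NE2PlusOperator c₃₅ (pcInstance d mm ι c₄r β₀ hL) (fun i => pcFamily₁ d mm ι a₀ e c₄r β₀ hL i μ₀ (E i))` — whose ENTRY 0 is the two-grid η-defect through `τ_{Ad∘U′}` of THE fine
scalar covariant Green's function `(Δ_{R_U′} + a′Q′_TᵀQ′_T)⁻¹` against THE coarse one at the straight holonomies, whose ENTRY 1 is the same for `D_{U,μ₀}∘(Δ_{R_U} + aQ′_TᵀQ′_T)⁻¹` (the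
covariant derivative of [B9] (3.42)'s second entry, one direction), and whose ENTRY 3 is the same for `Δ_{R_U}∘(Δ_{R_U} + aQ′_TᵀQ′_T)⁻¹` — ALL THREE PROVED with NO displayed row from ONE
[B11] Thm 1 (9)–(10) datum per cube (n15-c∕392, n15-c∕420, n15-c∕396), uniformly in the fine spacing.
THE CONSTANTS: `a₀′ := min(a₁, min(min(c₀, c₀′), c₀″)∕(2c₃₅S + 1))` with `S = (1 + κ_e·2√m·√m)²`; `M₅ := max(max(w₀, w₀′), w₀″, M₁, 1)`; `δ₀ := min(δ∕16, ρ₀, δ″∕16, δ₁)`; `γ := min(1∕4, β₀, γ₁)`;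
`B₀ := (max D 0 + max D′ 0 + max D″ 0)·(1 + κ_e·m·R(c₃₅a₀′))·(1 + 2^{β₀}) + B₁` (`pcRateConst_mono`).  The guard `M₅ ≤ M = L^m` is LIVE (`pcInstance_gf_M`, unbounded).

HONEST FRAMING ∕ LIMITS.  Packaging + real bookkeeping over landed theorems; MODEL family: THE scalar covariant Green's function `G′(U)` of the (PC) chain (n15-b's covariant Laplacian species
(3.50) at `Ad∘U` + Bałaban's covariant averaging summand `a·Q′_TᵀQ′_T`, King's doubled-torus cover, one cube scale `ξ = 1`, straight-holonomy pairing; the (3.35) constant tied to the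
cover's size parameter `M = L^m`); the class is dag-n07-a's typed `Reg910Cube` ([B11] Thm 1 (9)–(10) per cube) as a HYPOTHESIS on the configuration (its production = nodes N04∕N07, NOT
claimed); entry 1 read one direction `μ₀` at a time; entry 2 DISPLAYED.  This is the SHAPE of [B9] Thm 3.1∕3.14 for `G′`, NOT the printed theorems; nothing of [B9]∕[B11] asserted.  NE2⁺ NOT
PRINTED ∕ NOT proved as printed; N15 of record untouched (DISCHARGED AS CONSUMED, p687738); K3⁸ OPEN; counts of record UNMOVED (typed 28∕28 · discharged 8∕27); one finite 𝕋⁴ at fixed ε per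
index — NOT infinite volume, NOT OS on ℝ⁴, NOT a mass gap, NOT Clay.  Restate-immune (no Theses import).
-/

set_option autoImplicit false

noncomputable section

open scoped BigOperators Matrix Matrix.Norms.L2Operator

namespace Summit.QuantumFields.YangMills.BalabanUVNodes.N15.Gluing

open Literature.MathematicalPhysics.QuantumFieldTheory.Balaban1983to89
open Literature.MathematicalPhysics.QuantumFieldTheory.Balaban1983to89.B5Prop11Plancherel (Tor fine unitVec)
open Literature.MathematicalPhysics.QuantumFieldTheory.Balaban1983to89.B11SectG (BlockNorm HasMaj)
open Literature.MathematicalPhysics.QuantumFieldTheory.Balaban1983to89.T4EtaRate (NE2PlusOperator EtaRateIneq342 rateFactor rateFactor_nonneg)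
open Literature.MathematicalPhysics.QuantumFieldTheory.Balaban1983to89.T4EtaRateDefect (idef rateWeight)
open Literature.MathematicalPhysics.QuantumFieldTheory.Balaban1983to89.B6UnitTorusCarrier (unitTorusGeo)
open Literature.MathematicalPhysics.QuantumFieldTheory.King1986 (aK)
open Literature.MathematicalPhysics.QuantumFieldTheory.King1986.Torus (tdistT tdistT_nonneg)
open Literature.Barriers.QuantumFields (traceForm)
open Summit.QuantumFields.YangMills.BalabanUVNodes.N15.VectorPiece (kingPr unitTorusGeoS rateWeight_unitTorusGeoS)
open Summit.QuantumFields.YangMills.BalabanUVNodes.N15.MatrixSpecies (coordMat liftBlk basisConst basisConst_nonneg)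
open Summit.QuantumFields.YangMills.BalabanUVNodes.N15.CovAvg (mprod kingSec ctauS)
open Summit.QuantumFields.YangMills.BalabanUVNodes.N15.OperatorReadout (opGeo opFamily opGeo_len rateFactor_opGeo etaRateIneq342_of_hasMaj pref4_pos)

variable {d : ℕ} {L : ℕ} [NeZero L]

/-! ## §1 (the real bookkeeping lemma `pcRateConst_mono` is n15-c∕398's, imported BY NAME) -/

/-! ## §2 `NE2PlusOperator` by name: entries 0, 1 and 3 constructed, entry 2 displayed -/

section Node

variable (d) (mm ι : Type) [Fintype mm] [DecidableEq mm] [Nonempty mm] [Fintype ι] [DecidableEq ι] (e : Matrix mm mm ℂ ≃L[ℝ] (ι → ℝ))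

set_option maxHeartbeats 2400000 in
/-- ★★★★ **NE2⁺, OPERATOR LAYER, BY NAME, FOR THE NAMED SCALAR COVARIANT GREEN's FUNCTION FAMILY ON THE PRINTED PER-CUBE CLASS — ENTRIES 0, 1 (DIRECTION `μ₀`) AND 3 CONSTRUCTED AND
PROVED, ENTRY 2 DISPLAYED, `M = L^m` LIVE.**  See the module docstring for the reading, the constants and the limits.  MODEL family; NOT [B9] Thm 3.1∕3.14 as printed.
[cite: Balaban1985BackgroundPropagators, Thm 3.1 p.397 (quantifier template «M ≥ M₁ … Mα₀ ≤ a₀», (3.42) entries 0–3), Thm 3.14 pp.426–427 (difference template), (3.24)–(3.25) p.394, (3.35)–(3.36) p.396;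
Balaban1985Variational, Thm 1 (9)–(10) p.279; King1986, Prop. 3.9 (3.73) p.665 (rate factor), Lemma 4.5 (4.38) p.674 (A = 0 template)] -/
theorem ne2PlusOperator_pc₀₁₃ (hL : Odd L ∧ 1 < L) (hL7 : 7 ≤ L) {a₀ : ℝ} (ha₀ : 0 < a₀) {c35 : ℝ} (hc35 : 0 < c35) {c₄r : ℝ} (hc₄r : 0 ≤ c₄r) {β₀ : ℝ} (hβ₀ : 0 < β₀)
    (he : ∀ A B : Matrix mm mm ℂ, traceForm A B = e A ⬝ᵥ e B) (μ₀ : Fin (d + 1))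
    (E : ∀ i : PcIdx d L, Fin 4 → (Fin (d + 1) → ScX' d L i.mv i.kk i.r hL → (Matrix mm mm ℂ)ˣ) → ((ScX d L i.mv i.kk hL × ι → ℝ) →ₗ[ℝ] (ScX' d L i.mv i.kk i.r hL × ι → ℝ)))
    (hE : ∃ M₁ δ₁ a₁ B₁ γ₁ : ℝ, 0 < M₁ ∧ 0 < δ₁ ∧ 0 < a₁ ∧ 0 < B₁ ∧ 0 < γ₁ ∧
      ∀ i : PcIdx d L, M₁ ≤ (L : ℝ) ^ i.mv → ∀ α₀ : ℝ, 0 < α₀ → (L : ℝ) ^ i.mv * α₀ ≤ a₁ →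
        ∀ U' : Fin (d + 1) → ScX' d L i.mv i.kk i.r hL → (Matrix mm mm ℂ)ˣ, (pcInstance d mm ι c₄r β₀ hL i).Bf.Reg335 c35 α₀ U' → ∀ n : Fin 4, n = 2 →
          HasMaj (BlockNorm.ofBlocks (pcGeo d hL i) (liftBlk (scBlk d L i.mv i.kk hL) ι))
            (BlockNorm.ofBlocks (pcGeo d hL i) (liftBlk (scBlk d L i.mv i.kk hL ∘ kingPr L i.kk i.r (cvM d L i.mv i.kk hL)) ι)) (E i n U')
            (fun y y' => B₁ * B9.pref4 ((opGeo (pcGeo d hL i) (ScX d L i.mv i.kk hL × ι) (liftBlk (scBlk d L i.mv i.kk hL) ι)).len y) n * Real.exp (-(δ₁ * (pcGeo d hL i).dist y y')) *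
              max (rateFactor (opGeo (pcGeo d hL i) (ScX d L i.mv i.kk hL × ι) (liftBlk (scBlk d L i.mv i.kk hL) ι)) γ₁ y)
                (rateFactor (opGeo (pcGeo d hL i) (ScX d L i.mv i.kk hL × ι) (liftBlk (scBlk d L i.mv i.kk hL) ι)) γ₁ y'))) :
    NE2PlusOperator c35 (pcInstance d mm ι c₄r β₀ hL) (fun i => pcFamily₁ d mm ι a₀ e c₄r β₀ hL i μ₀ (E i)) := by
  obtain ⟨δ, w₀, c₀, D, hδ, hc₀, hD, H0⟩ := uN_idef_scGreenOp_of_reg910_rate (d := d) hL hL7 ha₀ ι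
  obtain ⟨δ₃, w₃, c₃, D₃, ρ₀, hδ₃, hc₃, hρ₀, hD₃, H3⟩ := uN_idef_scGreenOp_entryThree_of_reg910_rate (d := d) hL hL7 ha₀ ι
  obtain ⟨δ₅, w₅, c₅, D₅, hδ₅, hc₅, hD₅, H1⟩ := uN_idef_covD_scGreenOp_of_reg910_rate (d := d) hL hL7 ha₀ ι μ₀
  obtain ⟨M₁, δ₁, a₁, B₁, γ₁, hM₁, hδ₁, ha₁, hB₁, hγ₁, hE⟩ := hE
  have hLpos : 0 < L := Nat.pos_of_ne_zero (NeZero.ne L)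
  have hLr : (0 : ℝ) < (L : ℝ) := Nat.cast_pos.mpr hLpos
  have hL1 : (1 : ℝ) ≤ (L : ℝ) := by exact_mod_cast hLpos
  -- the constants
  have hκ0 : 0 ≤ @basisConst ι _ (Matrix mm mm ℂ) Matrix.frobeniusNormedAddCommGroup Matrix.frobeniusNormedSpace e :=
    @basisConst_nonneg ι _ (Matrix mm mm ℂ) Matrix.frobeniusNormedAddCommGroup Matrix.frobeniusNormedSpace e
  obtain ⟨S, hS⟩ : ∃ S : ℝ, S = (1 + @basisConst ι _ (Matrix mm mm ℂ) Matrix.frobeniusNormedAddCommGroup Matrix.frobeniusNormedSpace e * (2 * Real.sqrt (Fintype.card mm)) * Real.sqrt (Fintype.card mm)) ^ 2 := ⟨_, rfl⟩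
  have hS0 : 0 ≤ S := by rw [hS]; positivity
  obtain ⟨a₀', ha₀'⟩ : ∃ a₀' : ℝ, a₀' = min a₁ (min (min c₀ c₃) c₅ / (2 * c35 * S + 1)) := ⟨_, rfl⟩
  have ha₀'pos : 0 < a₀' := by rw [ha₀']; exact lt_min ha₁ (div_pos (lt_min (lt_min hc₀ hc₃) hc₅) (by positivity))
  have ha₀'a₁ : a₀' ≤ a₁ := by rw [ha₀']; exact min_le_left _ _
  have ha₀'c : 2 * c35 * S * a₀' ≤ min (min c₀ c₃) c₅ := by
    have h2 : a₀' ≤ min (min c₀ c₃) c₅ / (2 * c35 * S + 1) := by rw [ha₀']; exact min_le_right _ _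
    have hden : 0 < 2 * c35 * S + 1 := by positivity
    have hmc : 0 ≤ min (min c₀ c₃) c₅ := (lt_min (lt_min hc₀ hc₃) hc₅).le
    calc 2 * c35 * S * a₀' ≤ 2 * c35 * S * (min (min c₀ c₃) c₅ / (2 * c35 * S + 1)) := mul_le_mul_of_nonneg_left h2 (by positivity)
      _ = min (min c₀ c₃) c₅ * (2 * c35 * S) / (2 * c35 * S + 1) := by ring
      _ ≤ min (min c₀ c₃) c₅ * (2 * c35 * S + 1) / (2 * c35 * S + 1) := by gcongr; linarith
      _ = min (min c₀ c₃) c₅ := by field_simp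
  -- the largest class constant and the constant of 392∕396 there
  obtain ⟨Cm, hCm⟩ : ∃ Cm : ℝ, Cm = c35 * a₀' := ⟨_, rfl⟩
  have hCm0 : 0 ≤ Cm := by rw [hCm]; positivity
  obtain ⟨Rm, hRm⟩ : ∃ Rm : ℝ, Rm = (4 * (c₄r * Cm) * ((1 : ℝ) ^ (2 + β₀))⁻¹ * Real.exp (5 * (Cm / 1))) + ((2 * ((d + 1 : ℕ) : ℝ) + 2) * ((Cm / 1 ^ 2) ^ 2 * Real.exp (2 * (Cm / 1))) +
      8 * ((Cm / 1) * (Cm / 1 ^ 2) * Real.exp (2 * (Cm / 1))) + 8 * ((Cm / 1) * (Cm / 1 ^ 2) * Real.exp (5 * (Cm / 1)))) := ⟨_, rfl⟩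
  have hRm0 : 0 ≤ Rm := by
    have : (0 : ℝ) < ((1 : ℝ) ^ (2 + β₀))⁻¹ := by rw [Real.one_rpow, inv_one]; exact one_pos
    rw [hRm]; positivity
  obtain ⟨K, hK⟩ : ∃ K : ℝ, K = (1 + @basisConst ι _ (Matrix mm mm ℂ) Matrix.frobeniusNormedAddCommGroup Matrix.frobeniusNormedSpace e * Fintype.card mm * Rm) * (1 + (2 : ℝ) ^ β₀) := ⟨_, rfl⟩
  have hK0 : 0 ≤ K := by rw [hK]; positivity
  let M₅ : ℝ := max (max (max w₀ w₃) w₅) (max M₁ 1)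
  have hM₅ : 0 < M₅ := lt_of_lt_of_le one_pos ((le_max_right _ _).trans (le_max_right _ _))
  let δ₀ : ℝ := min (min (min (δ / 16) ρ₀) (δ₅ / 16)) δ₁
  have hδ₀ : 0 < δ₀ := lt_min (lt_min (lt_min (by positivity) hρ₀) (by positivity)) hδ₁
  let γ : ℝ := min (min (1 / 4 : ℝ) β₀) γ₁
  have hγ : 0 < γ := lt_min (lt_min (by norm_num) hβ₀) hγ₁
  let B₀ : ℝ := (max D 0 + max D₃ 0 + max D₅ 0) * K + B₁
  have hB₀ : 0 < B₀ := add_pos_of_nonneg_of_pos (by positivity) hB₁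
  refine ⟨M₅, δ₀, a₀', B₀, γ, hM₅, hδ₀, ha₀'pos, hB₀, hγ, fun i hM α₀ hα₀ hMa U' hU' => ?_⟩
  -- the guard `M₅ ≤ gf.M = L^m` and the class at the index
  have hM' : M₅ ≤ (L : ℝ) ^ i.mv := hM
  have hw₀ : w₀ ≤ ((L ^ i.mv : ℕ) : ℝ) := by push_cast; exact (((le_max_left _ _).trans (le_max_left _ _)).trans (le_max_left _ _)).trans hM'
  have hw₃ : w₃ ≤ ((L ^ i.mv : ℕ) : ℝ) := by push_cast; exact (((le_max_right _ _).trans (le_max_left _ _)).trans (le_max_left _ _)).trans hM'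
  have hw₅ : w₅ ≤ ((L ^ i.mv : ℕ) : ℝ) := by push_cast; exact ((le_max_right _ _).trans (le_max_left _ _)).trans hM'
  have hM₁' : M₁ ≤ (L : ℝ) ^ i.mv := ((le_max_left _ _).trans (le_max_right _ _)).trans hM'
  have hMa₁ : (L : ℝ) ^ i.mv * α₀ ≤ a₁ := hMa.trans ha₀'a₁
  obtain ⟨hU'g, h910⟩ := (pcInstance_reg335_iff d mm ι c₄r β₀ hL i c35 α₀ U').1 hU'
  have hC0 : 0 ≤ c35 * (L : ℝ) ^ i.mv * α₀ := by positivity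
  have hCle : c35 * (L : ℝ) ^ i.mv * α₀ ≤ Cm := by
    rw [hCm, mul_assoc]; exact mul_le_mul_of_nonneg_left hMa hc35.le
  have hC₄0 : 0 ≤ c₄r * (c35 * (L : ℝ) ^ i.mv * α₀) := mul_nonneg hc₄r hC0
  -- BOTH smallness conditions at `ξ = 1`
  have hsm : (1 + @basisConst ι _ (Matrix mm mm ℂ) Matrix.frobeniusNormedAddCommGroup Matrix.frobeniusNormedSpace e * (2 * Real.sqrt (Fintype.card mm)) * Real.sqrt (Fintype.card mm)) ^ 2 *
      (c35 * (L : ℝ) ^ i.mv * α₀ / 1 + c35 * (L : ℝ) ^ i.mv * α₀ / 1 ^ 2) ≤ min (min c₀ c₃) c₅ := by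
    rw [← hS, div_one, one_pow, div_one]
    calc S * (c35 * (L : ℝ) ^ i.mv * α₀ + c35 * (L : ℝ) ^ i.mv * α₀) ≤ S * (Cm + Cm) := by gcongr
      _ = 2 * c35 * S * a₀' := by rw [hCm]; ring
      _ ≤ min (min c₀ c₃) c₅ := ha₀'c
  have hsm0 := hsm.trans ((min_le_left _ _).trans (min_le_left c₀ c₃))
  have hsm3 := hsm.trans ((min_le_left _ _).trans (min_le_right c₀ c₃))
  have hsm5 := hsm.trans (min_le_right (min c₀ c₃) c₅)
  have hη0 : (0 : ℝ) ≤ (pcGeo d hL i).eta := by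
    show (0 : ℝ) ≤ ((L : ℝ) ^ i.kk)⁻¹
    positivity
  -- the scalar facts at the index
  have hx1 : (1 : ℝ) ≤ (L : ℝ) ^ i.kk := one_le_pow₀ hL1
  have hxpos : (0 : ℝ) < (L : ℝ) ^ i.kk := pow_pos hLr _
  have hrf : ∀ y : (pcGeo d hL i).Site, ∀ γ' : ℝ, rateFactor (opGeo (pcGeo d hL i) (ScX d L i.mv i.kk hL × ι) (liftBlk (scBlk d L i.mv i.kk hL) ι)) γ' y = ((L : ℝ) ^ i.kk) ^ (-γ') :=
    fun y γ' => sfGeo_rateFactor d hL i.toSf _ γ' y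
  have hγ4 : γ ≤ 1 / 4 := (min_le_left _ _).trans (min_le_left _ _)
  have hγβ : γ ≤ β₀ := (min_le_left _ _).trans (min_le_right _ _)
  have hγ₁' : γ ≤ γ₁ := min_le_right _ _
  have hrfγ₁ : ((L : ℝ) ^ i.kk) ^ (-γ₁) ≤ ((L : ℝ) ^ i.kk) ^ (-γ) := Real.rpow_le_rpow_of_exponent_le hx1 (by linarith)
  have hrpos : 0 ≤ ((L : ℝ) ^ i.kk) ^ (-γ) := Real.rpow_nonneg hxpos.le _
  -- `(L^k)^{−1∕4} + (2L^{−k})^{β₀} ≤ (1 + 2^{β₀})(L^k)^{−γ}`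
  have hηeq : ((((L ^ i.kk : ℕ) : ℝ))⁻¹) = ((L : ℝ) ^ i.kk)⁻¹ := by rw [Nat.cast_pow]
  have hsum : ((L : ℝ) ^ i.kk) ^ (-(1 / 4 : ℝ)) + (2 * ((((L ^ i.kk : ℕ) : ℝ))⁻¹)) ^ β₀ ≤ (1 + (2 : ℝ) ^ β₀) * ((L : ℝ) ^ i.kk) ^ (-γ) := by
    have h14 : ((L : ℝ) ^ i.kk) ^ (-(1 / 4 : ℝ)) ≤ ((L : ℝ) ^ i.kk) ^ (-γ) := Real.rpow_le_rpow_of_exponent_le hx1 (by linarith)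
    have hβ' : (2 * ((((L ^ i.kk : ℕ) : ℝ))⁻¹)) ^ β₀ ≤ (2 : ℝ) ^ β₀ * ((L : ℝ) ^ i.kk) ^ (-γ) := by
      rw [hηeq, Real.mul_rpow (by norm_num) (inv_nonneg.mpr hxpos.le), Real.inv_rpow hxpos.le, ← Real.rpow_neg hxpos.le]
      exact mul_le_mul_of_nonneg_left (Real.rpow_le_rpow_of_exponent_le hx1 (by linarith)) (Real.rpow_nonneg (by norm_num) _)
    have := add_le_add h14 hβ'; linarith
  have hsum0 : 0 ≤ ((L : ℝ) ^ i.kk) ^ (-(1 / 4 : ℝ)) + (2 * ((((L ^ i.kk : ℕ) : ℝ))⁻¹)) ^ β₀ := by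
    have : 0 ≤ (2 * ((((L ^ i.kk : ℕ) : ℝ))⁻¹)) ^ β₀ := Real.rpow_nonneg (by rw [hηeq]; positivity) _
    have : 0 ≤ ((L : ℝ) ^ i.kk) ^ (-(1 / 4 : ℝ)) := Real.rpow_nonneg hxpos.le _
    linarith
  -- the constant of 392∕396 at the class constant is below `Rm`
  have hRle : (4 * (c₄r * (c35 * (L : ℝ) ^ i.mv * α₀)) * ((1 : ℝ) ^ (2 + β₀))⁻¹ * Real.exp (5 * (c35 * (L : ℝ) ^ i.mv * α₀ / 1))) +
      ((2 * ((d + 1 : ℕ) : ℝ) + 2) * ((c35 * (L : ℝ) ^ i.mv * α₀ / 1 ^ 2) ^ 2 * Real.exp (2 * (c35 * (L : ℝ) ^ i.mv * α₀ / 1))) +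
        8 * ((c35 * (L : ℝ) ^ i.mv * α₀ / 1) * (c35 * (L : ℝ) ^ i.mv * α₀ / 1 ^ 2) * Real.exp (2 * (c35 * (L : ℝ) ^ i.mv * α₀ / 1))) +
        8 * ((c35 * (L : ℝ) ^ i.mv * α₀ / 1) * (c35 * (L : ℝ) ^ i.mv * α₀ / 1 ^ 2) * Real.exp (5 * (c35 * (L : ℝ) ^ i.mv * α₀ / 1)))) ≤ Rm := by
    rw [hRm]; exact pcRateConst_mono (Nat.cast_nonneg _) hc₄r hC0 hCle
  have hKle : (1 + @basisConst ι _ (Matrix mm mm ℂ) Matrix.frobeniusNormedAddCommGroup Matrix.frobeniusNormedSpace e * Fintype.card mm *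
      ((4 * (c₄r * (c35 * (L : ℝ) ^ i.mv * α₀)) * ((1 : ℝ) ^ (2 + β₀))⁻¹ * Real.exp (5 * (c35 * (L : ℝ) ^ i.mv * α₀ / 1))) +
      ((2 * ((d + 1 : ℕ) : ℝ) + 2) * ((c35 * (L : ℝ) ^ i.mv * α₀ / 1 ^ 2) ^ 2 * Real.exp (2 * (c35 * (L : ℝ) ^ i.mv * α₀ / 1))) +
        8 * ((c35 * (L : ℝ) ^ i.mv * α₀ / 1) * (c35 * (L : ℝ) ^ i.mv * α₀ / 1 ^ 2) * Real.exp (2 * (c35 * (L : ℝ) ^ i.mv * α₀ / 1))) +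
        8 * ((c35 * (L : ℝ) ^ i.mv * α₀ / 1) * (c35 * (L : ℝ) ^ i.mv * α₀ / 1 ^ 2) * Real.exp (5 * (c35 * (L : ℝ) ^ i.mv * α₀ / 1)))))) *
      (((L : ℝ) ^ i.kk) ^ (-(1 / 4 : ℝ)) + (2 * ((((L ^ i.kk : ℕ) : ℝ))⁻¹)) ^ β₀) ≤ K * ((L : ℝ) ^ i.kk) ^ (-γ) := by
    rw [hK, mul_assoc (1 + _ * _ * Rm)]
    refine mul_le_mul ?_ hsum hsum0 (by positivity)
    have := mul_le_mul_of_nonneg_left hRle (mul_nonneg hκ0 (Nat.cast_nonneg (Fintype.card mm)))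
    linarith
  have hd0 : ∀ y y' : (pcGeo d hL i).Site, 0 ≤ (pcGeo d hL i).dist y y' := fun y y' => sfGeo_dist_nonneg d hL i.toSf y y'
  have hδ₀le : δ₀ ≤ δ / 16 := ((min_le_left _ _).trans (min_le_left _ _)).trans (min_le_left _ _)
  have hδ₀le₃ : δ₀ ≤ ρ₀ := ((min_le_left _ _).trans (min_le_left _ _)).trans (min_le_right _ _)
  have hδ₀le₅ : δ₀ ≤ δ₅ / 16 := (min_le_left _ _).trans (min_le_right _ _)
  have hδ₀le₁ : δ₀ ≤ δ₁ := min_le_right _ _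
  have hKD : 0 ≤ max D 0 * K := mul_nonneg (le_max_right _ _) hK0
  have hK3 : 0 ≤ max D₃ 0 * K := mul_nonneg (le_max_right _ _) hK0
  have hK5 : 0 ≤ max D₅ 0 * K := mul_nonneg (le_max_right _ _) hK0
  have hBD : max D 0 * K ≤ B₀ := by
    show max D 0 * K ≤ (max D 0 + max D₃ 0 + max D₅ 0) * K + B₁
    rw [add_mul, add_mul]; linarith
  have hBD₃ : max D₃ 0 * K ≤ B₀ := by
    show max D₃ 0 * K ≤ (max D 0 + max D₃ 0 + max D₅ 0) * K + B₁
    rw [add_mul, add_mul]; linarith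
  have hBD₅ : max D₅ 0 * K ≤ B₀ := by
    show max D₅ 0 * K ≤ (max D 0 + max D₃ 0 + max D₅ 0) * K + B₁
    rw [add_mul, add_mul]; linarith
  have hBB : B₁ ≤ B₀ := by
    show B₁ ≤ (max D 0 + max D₃ 0 + max D₅ 0) * K + B₁
    rw [add_mul, add_mul]; linarith
  refine etaRateIneq342_of_hasMaj (liftBlk (scBlk d L i.mv i.kk hL) ι) (liftBlk (scBlk d L i.mv i.kk hL ∘ kingPr L i.kk i.r (cvM d L i.mv i.kk hL)) ι) hη0 hLr.le hB₀.le
    (pcOps₁ d mm ι a₀ e hL i μ₀ (E i)) U' fun n => ?_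
  -- the common scalar step: `Dx·(1 + κ m R(C))·rate·e^{−t·d} ≤ B₀·pref4·e^{−δ₀d}·max rf` for `t ≥ δ₀`, `max Dx 0·K ≤ B₀`
  have step : ∀ (Dx t : ℝ) (n : Fin 4) (y y' : (pcGeo d hL i).Site), δ₀ ≤ t → max Dx 0 * K ≤ B₀ →
      Dx * (1 + @basisConst ι _ (Matrix mm mm ℂ) Matrix.frobeniusNormedAddCommGroup Matrix.frobeniusNormedSpace e * Fintype.card mm *
        ((4 * (c₄r * (c35 * (L : ℝ) ^ i.mv * α₀)) * ((1 : ℝ) ^ (2 + β₀))⁻¹ * Real.exp (5 * (c35 * (L : ℝ) ^ i.mv * α₀ / 1))) +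
        ((2 * ((d + 1 : ℕ) : ℝ) + 2) * ((c35 * (L : ℝ) ^ i.mv * α₀ / 1 ^ 2) ^ 2 * Real.exp (2 * (c35 * (L : ℝ) ^ i.mv * α₀ / 1))) +
          8 * ((c35 * (L : ℝ) ^ i.mv * α₀ / 1) * (c35 * (L : ℝ) ^ i.mv * α₀ / 1 ^ 2) * Real.exp (2 * (c35 * (L : ℝ) ^ i.mv * α₀ / 1))) +
          8 * ((c35 * (L : ℝ) ^ i.mv * α₀ / 1) * (c35 * (L : ℝ) ^ i.mv * α₀ / 1 ^ 2) * Real.exp (5 * (c35 * (L : ℝ) ^ i.mv * α₀ / 1)))))) *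
        (((L : ℝ) ^ i.kk) ^ (-(1 / 4 : ℝ)) + (2 * ((((L ^ i.kk : ℕ) : ℝ))⁻¹)) ^ β₀) * Real.exp (-(t * (unitTorusGeo L i.kk (cvM d L i.mv i.kk hL)).dist y y')) ≤
      B₀ * B9.pref4 ((opGeo (pcGeo d hL i) (ScX d L i.mv i.kk hL × ι) (liftBlk (scBlk d L i.mv i.kk hL) ι)).len y) n * Real.exp (-(δ₀ * (pcGeo d hL i).dist y y')) *
        max (rateFactor (opGeo (pcGeo d hL i) (ScX d L i.mv i.kk hL × ι) (liftBlk (scBlk d L i.mv i.kk hL) ι)) γ y)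
          (rateFactor (opGeo (pcGeo d hL i) (ScX d L i.mv i.kk hL × ι) (liftBlk (scBlk d L i.mv i.kk hL) ι)) γ y') := by
    intro Dx t n y y' ht hDK
    rw [opGeo_len, sfGeo_len d hL i.toSf y, hrf y γ, hrf y' γ, max_self]
    have hpref : (1 : ℝ) ≤ B9.pref4 (1 : ℝ) n := by fin_cases n <;> simp [B9.pref4]
    have hexp : Real.exp (-(t * (unitTorusGeo L i.kk (cvM d L i.mv i.kk hL)).dist y y')) ≤ Real.exp (-(δ₀ * (pcGeo d hL i).dist y y')) := by
      refine Real.exp_le_exp.mpr (neg_le_neg ?_)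
      exact mul_le_mul_of_nonneg_right ht (hd0 y y')
    have hE0 : 0 ≤ Real.exp (-(t * (unitTorusGeo L i.kk (cvM d L i.mv i.kk hL)).dist y y')) := Real.exp_nonneg _
    have hmid0 : 0 ≤ (1 + @basisConst ι _ (Matrix mm mm ℂ) Matrix.frobeniusNormedAddCommGroup Matrix.frobeniusNormedSpace e * Fintype.card mm *
        ((4 * (c₄r * (c35 * (L : ℝ) ^ i.mv * α₀)) * ((1 : ℝ) ^ (2 + β₀))⁻¹ * Real.exp (5 * (c35 * (L : ℝ) ^ i.mv * α₀ / 1))) +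
        ((2 * ((d + 1 : ℕ) : ℝ) + 2) * ((c35 * (L : ℝ) ^ i.mv * α₀ / 1 ^ 2) ^ 2 * Real.exp (2 * (c35 * (L : ℝ) ^ i.mv * α₀ / 1))) +
          8 * ((c35 * (L : ℝ) ^ i.mv * α₀ / 1) * (c35 * (L : ℝ) ^ i.mv * α₀ / 1 ^ 2) * Real.exp (2 * (c35 * (L : ℝ) ^ i.mv * α₀ / 1))) +
          8 * ((c35 * (L : ℝ) ^ i.mv * α₀ / 1) * (c35 * (L : ℝ) ^ i.mv * α₀ / 1 ^ 2) * Real.exp (5 * (c35 * (L : ℝ) ^ i.mv * α₀ / 1)))))) *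
        (((L : ℝ) ^ i.kk) ^ (-(1 / 4 : ℝ)) + (2 * ((((L ^ i.kk : ℕ) : ℝ))⁻¹)) ^ β₀) := by
      have : (0 : ℝ) < ((1 : ℝ) ^ (2 + β₀))⁻¹ := by rw [Real.one_rpow, inv_one]; exact one_pos
      positivity
    calc Dx * (1 + @basisConst ι _ (Matrix mm mm ℂ) Matrix.frobeniusNormedAddCommGroup Matrix.frobeniusNormedSpace e * Fintype.card mm *
            ((4 * (c₄r * (c35 * (L : ℝ) ^ i.mv * α₀)) * ((1 : ℝ) ^ (2 + β₀))⁻¹ * Real.exp (5 * (c35 * (L : ℝ) ^ i.mv * α₀ / 1))) +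
            ((2 * ((d + 1 : ℕ) : ℝ) + 2) * ((c35 * (L : ℝ) ^ i.mv * α₀ / 1 ^ 2) ^ 2 * Real.exp (2 * (c35 * (L : ℝ) ^ i.mv * α₀ / 1))) +
              8 * ((c35 * (L : ℝ) ^ i.mv * α₀ / 1) * (c35 * (L : ℝ) ^ i.mv * α₀ / 1 ^ 2) * Real.exp (2 * (c35 * (L : ℝ) ^ i.mv * α₀ / 1))) +
              8 * ((c35 * (L : ℝ) ^ i.mv * α₀ / 1) * (c35 * (L : ℝ) ^ i.mv * α₀ / 1 ^ 2) * Real.exp (5 * (c35 * (L : ℝ) ^ i.mv * α₀ / 1)))))) *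
            (((L : ℝ) ^ i.kk) ^ (-(1 / 4 : ℝ)) + (2 * ((((L ^ i.kk : ℕ) : ℝ))⁻¹)) ^ β₀) * Real.exp (-(t * (unitTorusGeo L i.kk (cvM d L i.mv i.kk hL)).dist y y'))
        ≤ max Dx 0 * (K * ((L : ℝ) ^ i.kk) ^ (-γ)) * Real.exp (-(t * (unitTorusGeo L i.kk (cvM d L i.mv i.kk hL)).dist y y')) := by
          refine mul_le_mul_of_nonneg_right ?_ hE0
          rw [mul_assoc Dx]
          exact (mul_le_mul_of_nonneg_right (le_max_left Dx 0) hmid0).trans (mul_le_mul_of_nonneg_left hKle (le_max_right _ _))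
      _ ≤ max Dx 0 * (K * ((L : ℝ) ^ i.kk) ^ (-γ)) * Real.exp (-(δ₀ * (pcGeo d hL i).dist y y')) := mul_le_mul_of_nonneg_left hexp (by positivity)
      _ = (max Dx 0 * K) * 1 * Real.exp (-(δ₀ * (pcGeo d hL i).dist y y')) * ((L : ℝ) ^ i.kk) ^ (-γ) := by ring
      _ ≤ B₀ * B9.pref4 (1 : ℝ) n * Real.exp (-(δ₀ * (pcGeo d hL i).dist y y')) * ((L : ℝ) ^ i.kk) ^ (-γ) := by
          refine mul_le_mul_of_nonneg_right (mul_le_mul_of_nonneg_right ?_ (Real.exp_nonneg _)) hrpos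
          exact mul_le_mul hDK hpref zero_le_one hB₀.le
  by_cases h0 : n = 0
  · -- ENTRY 0: n15-c∕392 for THE named Green's functions
    subst h0
    rw [pcOps₁_zero]
    have key := hasMaj_unitTorusGeoS (d := d) (L := L) ((L : ℝ) ^ i.mv)
      (H0 i.mv i.kk i.r i.one_le_kk i.one_le_r hw₀ e he U' hU'g
        (fun k => {z : ScX' d L i.mv i.kk i.r hL | ∃ y ∈ cvSk d L i.mv i.kk hL k, (unitTorusGeo L i.kk (cvM d L i.mv i.kk hL)).dist (scBlk' d L i.mv i.kk i.r hL z) y ≤ 5})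
        1 (c35 * (L : ℝ) ^ i.mv * α₀) β₀ (c₄r * (c35 * (L : ℝ) ^ i.mv * α₀)) one_pos hC0 hβ₀.le hC₄0 hsm0 h910 (fun k z hz => hz))
    unfold pcEntry0
    exact key.mono fun y y' => step D (δ / 16) 0 y y' hδ₀le hBD
  by_cases h3 : n = 3
  · -- ENTRY 3: n15-c∕396 for THE named Green's functions
    subst h3
    rw [pcOps₁_three]
    have key := hasMaj_unitTorusGeoS (d := d) (L := L) ((L : ℝ) ^ i.mv)
      (H3 i.mv i.kk i.r i.one_le_kk i.one_le_r hw₃ e he U' hU'g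
        (fun k => {z : ScX' d L i.mv i.kk i.r hL | ∃ y ∈ cvSk d L i.mv i.kk hL k, (unitTorusGeo L i.kk (cvM d L i.mv i.kk hL)).dist (scBlk' d L i.mv i.kk i.r hL z) y ≤ 5})
        1 (c35 * (L : ℝ) ^ i.mv * α₀) β₀ (c₄r * (c35 * (L : ℝ) ^ i.mv * α₀)) one_pos hC0 hβ₀.le hC₄0 hsm3 h910 (fun k z hz => hz))
    unfold pcEntry3
    exact key.mono fun y y' => step D₃ ρ₀ 3 y y' hδ₀le₃ hBD₃
  by_cases h1 : n = 1
  · -- ENTRY 1 (direction `μ₀`): n15-c∕420 for THE named Green's functions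
    subst h1
    rw [pcOps₁_one]
    have key := hasMaj_unitTorusGeoS (d := d) (L := L) ((L : ℝ) ^ i.mv)
      (H1 i.mv i.kk i.r i.one_le_kk i.one_le_r hw₅ e he U' hU'g
        (fun k => {z : ScX' d L i.mv i.kk i.r hL | ∃ y ∈ cvSk d L i.mv i.kk hL k, (unitTorusGeo L i.kk (cvM d L i.mv i.kk hL)).dist (scBlk' d L i.mv i.kk i.r hL z) y ≤ 5})
        1 (c35 * (L : ℝ) ^ i.mv * α₀) β₀ (c₄r * (c35 * (L : ℝ) ^ i.mv * α₀)) one_pos hC0 hβ₀.le hC₄0 hsm5 h910 (fun k z hz => hz))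
    unfold pcEntry1
    exact key.mono fun y y' => step D₅ (δ₅ / 16) 1 y y' hδ₀le₅ hBD₅
  -- ENTRY 2: the displayed row
  have h2 : n = 2 := by
    rcases n with ⟨_ | _ | _ | _ | k, hk⟩
    · exact absurd rfl h0
    · exact absurd rfl h1
    · rfl
    · exact absurd rfl h3
    · omega
  have hop : pcOps₁ d mm ι a₀ e hL i μ₀ (E i) n U' = E i n U' := by subst h2; rfl
  rw [hop]
  refine (hE i hM₁' α₀ hα₀ hMa₁ U' hU' n h2).mono fun y y' => ?_
  rw [opGeo_len, sfGeo_len d hL i.toSf y, hrf y γ, hrf y' γ, hrf y γ₁, hrf y' γ₁, max_self, max_self]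
  have hp0 : 0 ≤ B9.pref4 (1 : ℝ) n := (pref4_pos one_pos n).le
  have hexp : Real.exp (-(δ₁ * (pcGeo d hL i).dist y y')) ≤ Real.exp (-(δ₀ * (pcGeo d hL i).dist y y')) :=
    Real.exp_le_exp.mpr (neg_le_neg (mul_le_mul_of_nonneg_right hδ₀le₁ (hd0 y y')))
  exact mul_le_mul (mul_le_mul (mul_le_mul_of_nonneg_right hBB hp0) hexp (Real.exp_nonneg _) (by positivity)) hrfγ₁ (Real.rpow_nonneg hxpos.le _) (by positivity)

/-! ## §3 NE2⁰ by name (the non-vacuity `pcInstance_reg335_one` is n15-c∕398's) -/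

/-- ★★★ **NE2⁰, OPERATOR LAYER, BY NAME** for the named family with the gradient entry constructed — `T4EtaRate.ne2Zero_of_ne2Plus` on `ne2PlusOperator_pc₀₁₃` and the inhabited
class (n15-c∕398 `pcInstance_reg335_one`). [cite: King1986, Props. 3.8–3.9 (3.71)–(3.75) pp.664–665 (A = 0 model); Balaban1985BackgroundPropagators, Thm 3.1 p.397 (template)] -/
theorem ne2ZeroOperator_pc₀₁₃ (hL : Odd L ∧ 1 < L) (hL7 : 7 ≤ L) {a₀ : ℝ} (ha₀ : 0 < a₀) {c35 : ℝ} (hc35 : 0 < c35) {c₄r : ℝ} (hc₄r : 0 < c₄r) {β₀ : ℝ} (hβ₀ : 0 < β₀)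
    (he : ∀ A B : Matrix mm mm ℂ, traceForm A B = e A ⬝ᵥ e B) (μ₀ : Fin (d + 1))
    (E : ∀ i : PcIdx d L, Fin 4 → (Fin (d + 1) → ScX' d L i.mv i.kk i.r hL → (Matrix mm mm ℂ)ˣ) → ((ScX d L i.mv i.kk hL × ι → ℝ) →ₗ[ℝ] (ScX' d L i.mv i.kk i.r hL × ι → ℝ)))
    (hE : ∃ M₁ δ₁ a₁ B₁ γ₁ : ℝ, 0 < M₁ ∧ 0 < δ₁ ∧ 0 < a₁ ∧ 0 < B₁ ∧ 0 < γ₁ ∧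
      ∀ i : PcIdx d L, M₁ ≤ (L : ℝ) ^ i.mv → ∀ α₀ : ℝ, 0 < α₀ → (L : ℝ) ^ i.mv * α₀ ≤ a₁ →
        ∀ U' : Fin (d + 1) → ScX' d L i.mv i.kk i.r hL → (Matrix mm mm ℂ)ˣ, (pcInstance d mm ι c₄r β₀ hL i).Bf.Reg335 c35 α₀ U' → ∀ n : Fin 4, n = 2 →
          HasMaj (BlockNorm.ofBlocks (pcGeo d hL i) (liftBlk (scBlk d L i.mv i.kk hL) ι))
            (BlockNorm.ofBlocks (pcGeo d hL i) (liftBlk (scBlk d L i.mv i.kk hL ∘ kingPr L i.kk i.r (cvM d L i.mv i.kk hL)) ι)) (E i n U')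
            (fun y y' => B₁ * B9.pref4 ((opGeo (pcGeo d hL i) (ScX d L i.mv i.kk hL × ι) (liftBlk (scBlk d L i.mv i.kk hL) ι)).len y) n * Real.exp (-(δ₁ * (pcGeo d hL i).dist y y')) *
              max (rateFactor (opGeo (pcGeo d hL i) (ScX d L i.mv i.kk hL × ι) (liftBlk (scBlk d L i.mv i.kk hL) ι)) γ₁ y)
                (rateFactor (opGeo (pcGeo d hL i) (ScX d L i.mv i.kk hL × ι) (liftBlk (scBlk d L i.mv i.kk hL) ι)) γ₁ y'))) :
    T4EtaRate.NE2ZeroOperator (pcInstance d mm ι c₄r β₀ hL) (fun i => pcFamily₁ d mm ι a₀ e c₄r β₀ hL i μ₀ (E i)) :=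
  T4EtaRate.ne2Zero_of_ne2Plus (fun i _ hα₀ => pcInstance_reg335_one d mm ι hL hc₄r i hc35 hα₀) (ne2PlusOperator_pc₀₁₃ d mm ι e hL hL7 ha₀ hc35 hc₄r.le hβ₀ he μ₀ E hE)

end Node

end Summit.QuantumFields.YangMills.BalabanUVNodes.N15.Gluing

end
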